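import Mathlib
import HarnessLib
import Literature.Probability.LatticeModels.LatticeGraph
import Summits.HubbardSuperconductivity.HubbardSuperconductivity.Theorems.BalabanIRBirComplexStableXYFixedVolumeLaplace
import Summits.HubbardSuperconductivity.HubbardSuperconductivity.Theorems.BalabanIRBirComplexStableXYFixedVolumeGauss
import Summits.HubbardSuperconductivity.HubbardSuperconductivity.Theorems.BalabanIRBirComplexStableXYFixedVolumeTorus
import Summits.HubbardSuperconductivity.HubbardSuperconductivity.Theorems.BalabanIRBirComplexStableXYFixedVolumeExpansion
import Summits.HubbardSuperconductivity.HubbardSuperconductivity.Theorems.BalabanIRBirComplexStableXYFixedVolumeAction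
import Summits.HubbardSuperconductivity.HubbardSuperconductivity.Theorems.BalabanIRBirComplexStableXYFixedVolumeLattice
import Summits.HubbardSuperconductivity.HubbardSuperconductivity.Theorems.BalabanIRBirComplexStableXYFixedVolumeCoercive

/-!
# BalabanIR engine `BirComplexStableXY` (stmt-HubbardSuperconductivity-2080): fixed-volume
stability of the typed engine class (the `∀∃`-swap of the crux)

Support theorem for crux 2 of route BalabanIR (`--supports stmt-HubbardSuperconductivity-2080`).
The crux `Theses.BalabanIR.BirComplexStableXY` asserts, UNIFORMLY in the admissible table `c`
and in the sizes `L₀ ≤ L ≤ M` (`∃ K₀ ∀ K ≥ K₀ ∀ c ∀ L M`), that `Z ≠ 0` and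
`Re (∫ O e^{-A} / Z) ≥ 1/2`.  The refuter record says this is false as typed
(Beraha–Kahane–Weiss zeros at `M ~ K² L⁴`).  This file proves that the POINTWISE version is a
theorem, for the objects exactly as typed in the route statement (same `sh`, `F`, `A`, `cube`,
`Z`, `O`) and WITHOUT the analyticity budget (A):

  `birFixedVolume_stable`: for `r ≥ 2`, `c₀ > 0`, every table `c` with (U1), (N), (C) and every
  `L, M ≥ 1` there is `K₁` with `Z ≠ 0 ∧ 1/2 ≤ Re (∫ O e^{-A} / Z)` for all `K ≥ K₁`.

So the only quantifier of the crux that can fail is the uniformity of `K₀` in `(c, L, M)`.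
Proof: fix the spin at `s₀ = 0` by the unimodular shear (`birTorus_shear`), expand the action to
second order around the aligned configuration ((N) and (U1) kill orders `0` and `1`,
`birExpand_norm_sub_quad_le`), bound its real part below by coercivity + connectivity of the
space-time torus (`birFixedVolume_re_action_coercive`), and apply the multidimensional Laplace
method (`birLaplace_tendsto_div`, `birLaplace_eventually_ne_zero`) with the non-vanishing of
the limiting complex Gaussian integral (`birGauss_integral_ne_zero`).  No definitions.
-/

namespace Summit.HubbardSuperconductivity.HubbardSuperconductivity.Theorems

open scoped BigOperators
open MeasureTheory Set Complex Filter Topology Literature.Probability.LatticeModels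

section FixedVolume

variable {r : ℕ} {L M : ℕ} [NeZero L] [NeZero M]

/-- **Fixed-volume asymptotics, parametrised form.**  For a local generating function `F`,
window shift `sh` and slice observable `O` given together with their defining equations
(hypotheses `hF`, `hsh`, `hO` are the `let`s of the route statement): for `r ≥ 2`, `c₀ > 0`,
(U1), (N), (C) and any `L, M ≥ 1`, the partition function over `[0,2π]^Λ` is eventually
non-zero as `K → ∞` and the slice order `∫ O e^{-A} / Z` tends to `1`. -/
theorem birFixedVolume_asymptotics_of (hr : 2 ≤ r) {c₀ : ℝ} (hc₀ : 0 < c₀)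
    (c : ((Fin r × Fin r × Fin r) → ℤ) →₀ ℂ)
    (hU1 : ∀ n ∈ c.support, ∑ w, n w = 0) (hN : c.sum (fun _ a => a) = 0)
    {F : ((Fin r × Fin r × Fin r) → ℝ) → ℂ}
    (hF : ∀ φ, F φ = c.sum (fun n a => a * cexp (I * ((∑ w, (n w : ℝ) * φ w : ℝ) : ℂ))))
    (hC : ∀ φ : (Fin r × Fin r × Fin r) → ℝ,
      c₀ * ∑ w, ∑ w', (1 - Real.cos (φ w - φ w')) ≤ (F φ).re)
    {sh : (TorusSite 2 L × ZMod M) → (Fin r × Fin r × Fin r) → (TorusSite 2 L × ZMod M)}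
    (hsh : ∀ s w, sh s w = (s.1 + ![((w.1 : ℕ) : ZMod L), ((w.2.1 : ℕ) : ZMod L)],
      s.2 + ((w.2.2 : ℕ) : ZMod M)))
    {O : ((TorusSite 2 L × ZMod M) → ℝ) → ℝ}
    (hO : ∀ θ, O θ = ‖∑ x : TorusSite 2 L, cexp (I * (θ (x, 0) : ℂ))‖ ^ 2 / (L : ℝ) ^ 4) :
    (∀ᶠ K : ℝ in atTop,
      (∫ θ in Set.pi univ (fun _ : TorusSite 2 L × ZMod M => Icc (0 : ℝ) (2 * Real.pi)),
          cexp (-((K : ℂ) * ∑ s, F (fun w => θ (sh s w))))) ≠ 0) ∧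
    Tendsto (fun K : ℝ =>
      (∫ θ in Set.pi univ (fun _ : TorusSite 2 L × ZMod M => Icc (0 : ℝ) (2 * Real.pi)),
          ((O θ : ℝ) : ℂ) * cexp (-((K : ℂ) * ∑ s, F (fun w => θ (sh s w))))) /
        (∫ θ in Set.pi univ (fun _ : TorusSite 2 L × ZMod M => Icc (0 : ℝ) (2 * Real.pi)),
          cexp (-((K : ℂ) * ∑ s, F (fun w => θ (sh s w)))))) atTop (𝓝 1) := by
  set s₀ : TorusSite 2 L × ZMod M := 0 with hs₀
  -- the sheared phase, amplitude and domain
  set f : ({i // i ≠ s₀} → ℝ) → ℂ := fun δ =>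
      ∑ s, F (fun w => (fun i => if h : i = s₀ then (0 : ℝ) else δ ⟨i, h⟩) (sh s w)) with hf
  set g : ({i // i ≠ s₀} → ℝ) → ℂ := fun δ =>
      ((O (fun i => if h : i = s₀ then (0 : ℝ) else δ ⟨i, h⟩) : ℝ) : ℂ) with hg
  set S : Set ({i // i ≠ s₀} → ℝ) := Set.pi univ (fun _ => Ioc (-Real.pi) Real.pi) with hS
  -- weights, linear forms, the matrix and the quadratic germ
  set wt : (TorusSite 2 L × ZMod M) × ↥c.support → ℂ := fun k => c k.2 with hwt
  set av : (TorusSite 2 L × ZMod M) × ↥c.support → {i // i ≠ s₀} → ℝ := fun k j =>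
      ∑ w, ((k.2 : (Fin r × Fin r × Fin r) → ℤ) w : ℝ) * (if sh k.1 w = j.1 then (1 : ℝ) else 0)
    with hav
  set Q : Matrix {i // i ≠ s₀} {i // i ≠ s₀} ℂ :=
      Matrix.of fun i j => -(∑ k, wt k * (av k i : ℂ) * av k j) with hQ
  set q : ({i // i ≠ s₀} → ℝ) → ℂ := fun u => (1 / 2 : ℂ) * ∑ i, ∑ j, Q i j * u i * u j with hq
  -- continuity and the expansion
  have hf_cont : Continuous f :=
    (birAct_continuous_action c hF sh).comp (birTorus_continuous_ext s₀)
  have hforms : ∀ δ, f δ = ∑ k, wt k * cexp (I * ((∑ j, av k j * δ j : ℝ) : ℂ)) :=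
    fun δ => birAct_action_eq_sum_forms c hF sh s₀ δ
  have hNw : ∑ k, wt k = 0 := birAct_weights_sum_eq_zero c hN
  have hUw : ∀ δ : {i // i ≠ s₀} → ℝ, ∑ k, wt k * ((∑ j, av k j * δ j : ℝ) : ℂ) = 0 :=
    fun δ => birAct_weighted_forms_eq_zero c hU1 hsh s₀ δ
  have hqm : ∀ δ : {i // i ≠ s₀} → ℝ,
      -(1 / 2 : ℂ) * ∑ k, wt k * ((∑ j, av k j * δ j : ℝ) : ℂ) ^ 2 = q δ := by
    intro δ
    rw [birExpand_quad_eq_matrix]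
    simp only [hq, hQ, Matrix.of_apply]
  have hrem : ∀ δ : {i // i ≠ s₀} → ℝ, ‖f δ - q δ‖
      ≤ ((∑ k, ‖wt k‖ * (∑ j, |av k j|) ^ 3) / 6) * (∑ j, δ j ^ 2) * ‖δ‖ := by
    intro δ
    have h := birExpand_norm_sub_quad_le wt av hNw hUw δ
    rwa [← hforms δ, hqm δ] at h
  have hqhom : ∀ (t : ℝ) (u : {i // i ≠ s₀} → ℝ), q (t • u) = (t : ℂ) ^ 2 * q u := by
    intro t u
    simp only [hq, Pi.smul_apply, smul_eq_mul, Complex.ofReal_mul, Finset.mul_sum]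
    refine Finset.sum_congr rfl fun i _ => Finset.sum_congr rfl fun j _ => ?_
    ring
  -- coercive lower bound on the half-open cube
  obtain ⟨m, hm, hre'⟩ := birFixedVolume_re_action_coercive hr hc₀ c hF hC hsh s₀
  have hreS : ∀ δ ∈ S, m * ∑ j, δ j ^ 2 ≤ (f δ).re := fun δ hδ =>
    hre' δ (Set.pi_mono (fun _ _ => Ioc_subset_Icc_self) hδ)
  have hremS : ∀ δ ∈ S, ‖f δ - q δ‖
      ≤ ((∑ k, ‖wt k‖ * (∑ j, |av k j|) ^ 3) / 6) * (∑ j, δ j ^ 2) * ‖δ‖ := fun δ _ => hrem δ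
  -- the domain
  have hSm : MeasurableSet S := MeasurableSet.univ_pi fun _ => measurableSet_Ioc
  have hS0 : S ∈ 𝓝 (0 : {i // i ≠ s₀} → ℝ) := by
    have hopen : IsOpen (Set.pi univ fun _ : {i // i ≠ s₀} => Ioo (-Real.pi) Real.pi) :=
      isOpen_set_pi finite_univ fun _ _ => isOpen_Ioo
    have hmem : (0 : {i // i ≠ s₀} → ℝ) ∈ Set.pi univ fun _ : {i // i ≠ s₀} => Ioo (-Real.pi) Real.pi := by
      simp [Real.pi_pos]
    exact mem_of_superset (hopen.mem_nhds hmem) (Set.pi_mono fun _ _ => Ioo_subset_Ioc_self)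
  -- the amplitudes
  have hg_cont : Continuous g :=
    Complex.continuous_ofReal.comp ((birAct_O_continuous hO).comp (birTorus_continuous_ext s₀))
  have hg_b : ∀ δ ∈ S, ‖g δ‖ ≤ 1 := by
    intro δ _
    simp only [hg, Complex.norm_real, Real.norm_eq_abs]
    rw [abs_of_nonneg (birLat_O_nonneg hO _)]
    exact birLat_O_le_one hO _
  have h1_b : ∀ δ ∈ S, ‖(fun _ : {i // i ≠ s₀} → ℝ => (1 : ℂ)) δ‖ ≤ 1 := fun δ _ => by simp
  have hext0 : (fun i : TorusSite 2 L × ZMod M =>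
      if h : i = s₀ then (0 : ℝ) else (0 : {i // i ≠ s₀} → ℝ) ⟨i, h⟩) = fun _ => 0 := by
    funext i
    by_cases h : i = s₀ <;> simp [h]
  have hg0 : g 0 = 1 := by
    simp only [hg, hext0, birLat_O_zero hO, Complex.ofReal_one]
  -- the limiting Gaussian integral does not vanish
  have hQsymm : Q.IsSymm := birExpand_matrix_isSymm wt av
  have hposQ : ∀ u : {i // i ≠ s₀} → ℝ, u ≠ 0 → 0 < (∑ i, ∑ j, Q i j * u i * u j).re := by
    intro u hu
    have hq2 : (∑ i, ∑ j, Q i j * u i * u j) = 2 * q u := by simp only [hq]; ring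
    have hre_q : m * ∑ j, u j ^ 2 ≤ (q u).re := birLaplace_re_quad_ge hS0 hqhom hreS hremS u
    have hsq : 0 < ∑ j, u j ^ 2 := birFixedVolume_sum_sq_pos hu
    have h2 : (2 * q u).re = 2 * (q u).re := by simp [Complex.mul_re]
    rw [hq2, h2]
    nlinarith
  have hGne : (∫ u : {i // i ≠ s₀} → ℝ, cexp (-q u)) ≠ 0 := by
    have h := birGauss_integral_ne_zero Q hQsymm hposQ
    have hfun : (fun u : {i // i ≠ s₀} → ℝ => cexp (-q u))
        = fun u => cexp (-(1 / 2 : ℂ) * ∑ i, ∑ j, Q i j * u i * u j) := by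
      funext u; simp only [hq, neg_mul]
    rw [hfun]; exact h
  have hne1 : (fun _ : {i // i ≠ s₀} → ℝ => (1 : ℂ)) 0 * ∫ u : {i // i ≠ s₀} → ℝ, cexp (-q u) ≠ 0 := by
    simpa using hGne
  -- the Laplace method
  have hev1 := birLaplace_eventually_ne_zero hSm hS0 hf_cont hqhom hm hreS hremS
    (g := fun _ => (1 : ℂ)) continuous_const h1_b hne1
  have hev2 := birLaplace_tendsto_div hSm hS0 hf_cont hqhom hm hreS hremS hg_cont
    continuous_const hg_b h1_b (by norm_num : (fun _ : {i // i ≠ s₀} → ℝ => (1 : ℂ)) 0 ≠ 0) hGne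
  simp only [hg0, div_one] at hev2
  -- the shear representations of `Z` and of the numerator, for every `K`
  have h2π : ((2 * Real.pi : ℝ) : ℂ) ≠ 0 := by exact_mod_cast Real.two_pi_pos.ne'
  have hZ : ∀ K : ℝ,
      (∫ θ in Set.pi univ (fun _ : TorusSite 2 L × ZMod M => Icc (0 : ℝ) (2 * Real.pi)),
        cexp (-((K : ℂ) * ∑ s, F (fun w => θ (sh s w)))))
      = ((2 * Real.pi : ℝ) : ℂ) * ∫ δ in S, (fun _ : {i // i ≠ s₀} → ℝ => (1 : ℂ)) δ *
          cexp (-((K : ℂ) * f δ)) := by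
    intro K
    have h := birFixedVolume_cube_to_shear s₀
      (Φ := fun θ : (TorusSite 2 L × ZMod M) → ℝ => cexp (-((K : ℂ) * ∑ s, F (fun w => θ (sh s w)))))
      (by have := birAct_continuous_action c hF sh; fun_prop)
      (fun θ k => congrArg (fun z => cexp (-((K : ℂ) * z))) (birAct_action_periodic c hF sh θ k))
      (fun θ α => congrArg (fun z => cexp (-((K : ℂ) * z))) (birAct_action_rotate c hU1 hF sh θ α))
    rw [h]
    congr 1
    refine setIntegral_congr_fun hSm fun δ _ => ?_
    simp only [one_mul, hf]
  have hNum : ∀ K : ℝ,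
      (∫ θ in Set.pi univ (fun _ : TorusSite 2 L × ZMod M => Icc (0 : ℝ) (2 * Real.pi)),
        ((O θ : ℝ) : ℂ) * cexp (-((K : ℂ) * ∑ s, F (fun w => θ (sh s w)))))
      = ((2 * Real.pi : ℝ) : ℂ) * ∫ δ in S, g δ * cexp (-((K : ℂ) * f δ)) := by
    intro K
    have h := birFixedVolume_cube_to_shear s₀
      (Φ := fun θ : (TorusSite 2 L × ZMod M) → ℝ =>
        ((O θ : ℝ) : ℂ) * cexp (-((K : ℂ) * ∑ s, F (fun w => θ (sh s w)))))
      (by have := birAct_O_continuous hO; have := birAct_continuous_action c hF sh; fun_prop)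
      (fun θ k => congrArg₂ (fun (x : ℝ) (z : ℂ) => (x : ℂ) * cexp (-((K : ℂ) * z)))
        (birAct_O_periodic hO θ k) (birAct_action_periodic c hF sh θ k))
      (fun θ α => congrArg₂ (fun (x : ℝ) (z : ℂ) => (x : ℂ) * cexp (-((K : ℂ) * z)))
        (birAct_O_rotate hO θ α) (birAct_action_rotate c hU1 hF sh θ α))
    rw [h]
  refine ⟨hev1.mono fun K hne => ?_, ?_⟩
  · rw [hZ K]
    exact mul_ne_zero h2π hne
  · refine hev2.congr' (Eventually.of_forall fun K => ?_)
    dsimp only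
    rw [hNum K, hZ K, mul_div_mul_left _ _ h2π]

/-- **Fixed-volume stability, parametrised form**: there is `K₁` such that for all `K ≥ K₁`
the partition function over `[0,2π]^Λ` is non-zero and the slice order is at least `1/2`. -/
theorem birFixedVolume_stable_of (hr : 2 ≤ r) {c₀ : ℝ} (hc₀ : 0 < c₀)
    (c : ((Fin r × Fin r × Fin r) → ℤ) →₀ ℂ)
    (hU1 : ∀ n ∈ c.support, ∑ w, n w = 0) (hN : c.sum (fun _ a => a) = 0)
    {F : ((Fin r × Fin r × Fin r) → ℝ) → ℂ}
    (hF : ∀ φ, F φ = c.sum (fun n a => a * cexp (I * ((∑ w, (n w : ℝ) * φ w : ℝ) : ℂ))))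
    (hC : ∀ φ : (Fin r × Fin r × Fin r) → ℝ,
      c₀ * ∑ w, ∑ w', (1 - Real.cos (φ w - φ w')) ≤ (F φ).re)
    {sh : (TorusSite 2 L × ZMod M) → (Fin r × Fin r × Fin r) → (TorusSite 2 L × ZMod M)}
    (hsh : ∀ s w, sh s w = (s.1 + ![((w.1 : ℕ) : ZMod L), ((w.2.1 : ℕ) : ZMod L)],
      s.2 + ((w.2.2 : ℕ) : ZMod M)))
    {O : ((TorusSite 2 L × ZMod M) → ℝ) → ℝ}
    (hO : ∀ θ, O θ = ‖∑ x : TorusSite 2 L, cexp (I * (θ (x, 0) : ℂ))‖ ^ 2 / (L : ℝ) ^ 4) :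
    ∃ K₁ : ℝ, ∀ K : ℝ, K₁ ≤ K →
      (∫ θ in Set.pi univ (fun _ : TorusSite 2 L × ZMod M => Icc (0 : ℝ) (2 * Real.pi)),
          cexp (-((K : ℂ) * ∑ s, F (fun w => θ (sh s w))))) ≠ 0 ∧
      (1 / 2 : ℝ) ≤ ((∫ θ in Set.pi univ (fun _ : TorusSite 2 L × ZMod M => Icc (0 : ℝ) (2 * Real.pi)),
          ((O θ : ℝ) : ℂ) * cexp (-((K : ℂ) * ∑ s, F (fun w => θ (sh s w))))) /
        (∫ θ in Set.pi univ (fun _ : TorusSite 2 L × ZMod M => Icc (0 : ℝ) (2 * Real.pi)),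
          cexp (-((K : ℂ) * ∑ s, F (fun w => θ (sh s w)))))).re := by
  obtain ⟨hev1, hev2⟩ := birFixedVolume_asymptotics_of hr hc₀ c hU1 hN hF hC hsh hO
  have hev3 := Metric.tendsto_nhds.1 hev2 (1 / 2) (by norm_num)
  obtain ⟨K₁, hK₁⟩ := eventually_atTop.1 (hev1.and hev3)
  refine ⟨K₁, fun K hK => ?_⟩
  obtain ⟨hne, hdist⟩ := hK₁ K hK
  refine ⟨hne, ?_⟩
  set z := (∫ θ in Set.pi univ (fun _ : TorusSite 2 L × ZMod M => Icc (0 : ℝ) (2 * Real.pi)),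
          ((O θ : ℝ) : ℂ) * cexp (-((K : ℂ) * ∑ s, F (fun w => θ (sh s w))))) /
        (∫ θ in Set.pi univ (fun _ : TorusSite 2 L × ZMod M => Icc (0 : ℝ) (2 * Real.pi)),
          cexp (-((K : ℂ) * ∑ s, F (fun w => θ (sh s w))))) with hz
  have hn : ‖z - 1‖ < 1 / 2 := by rwa [dist_eq_norm] at hdist
  have hre' : -‖z - 1‖ ≤ (z - 1).re := (abs_le.1 (Complex.abs_re_le_norm (z - 1))).1
  have : z.re = 1 + (z - 1).re := by simp
  rw [this]
  linarith

/-- **Fixed-volume stability of the typed engine class** (the `∀∃`-swap of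
`BirComplexStableXY`).  For `r ≥ 2`, `c₀ > 0`, a Fourier table `c` satisfying (U1), (N) and the
coercivity (C) of the item (no analyticity budget needed), and any sizes `L, M ≥ 1`, there is
`K₁` such that for all `K ≥ K₁` the typed partition function is non-zero and the typed slice
order is at least `1/2` (in fact it tends to `1`).  The objects `sh`, `F`, `A`, `cube`, `Z`, `O`
below are verbatim those of `Theses.BalabanIR.BirComplexStableXY`; only the quantifier over
`K` is moved inside (pointwise in `c`, `L`, `M`). -/
theorem birFixedVolume_stable (r : ℕ) (hr : 2 ≤ r) (c₀ : ℝ) (hc₀ : 0 < c₀)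
    (c : ((Fin r × Fin r × Fin r) → ℤ) →₀ ℂ)
    (hU1 : ∀ n ∈ c.support, ∑ w, n w = 0) (hN : c.sum (fun _ a => a) = 0)
    (hC : ∀ φ : (Fin r × Fin r × Fin r) → ℝ, c₀ * ∑ w, ∑ w', (1 - Real.cos (φ w - φ w')) ≤
      ((fun (φ : (Fin r × Fin r × Fin r) → ℝ) => c.sum (fun n a => a * Complex.exp (Complex.I *
        ((∑ w, (n w : ℝ) * φ w : ℝ) : ℂ)))) φ).re)
    (L M : ℕ) [NeZero L] [NeZero M] :
    ∃ K₁ : ℝ, ∀ K : ℝ, K₁ ≤ K →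
    let sh : (TorusSite 2 L × ZMod M) → (Fin r × Fin r × Fin r) → (TorusSite 2 L × ZMod M) :=
      fun s w => (s.1 + ![((w.1 : ℕ) : ZMod L), ((w.2.1 : ℕ) : ZMod L)], s.2 + ((w.2.2 : ℕ) : ZMod M))
    let F : ((Fin r × Fin r × Fin r) → ℝ) → ℂ := fun (φ : (Fin r × Fin r × Fin r) → ℝ) =>
      c.sum (fun n a => a * Complex.exp (Complex.I * ((∑ w, (n w : ℝ) * φ w : ℝ) : ℂ)))
    let A : ((TorusSite 2 L × ZMod M) → ℝ) → ℂ := fun θ => (K : ℂ) * ∑ s, F (fun w => θ (sh s w))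
    let cube : Set ((TorusSite 2 L × ZMod M) → ℝ) :=
      Set.pi Set.univ (fun _ => Set.Icc (0:ℝ) (2 * Real.pi))
    let Z : ℂ := MeasureTheory.integral (MeasureTheory.volume.restrict cube)
      (fun θ => Complex.exp (-(A θ)))
    let O : ((TorusSite 2 L × ZMod M) → ℝ) → ℝ := fun θ =>
      ‖∑ x : TorusSite 2 L, Complex.exp (Complex.I * (θ (x, 0) : ℂ))‖ ^ 2 / (L : ℝ) ^ 4
    Z ≠ 0 ∧ (1/2 : ℝ) ≤ ((MeasureTheory.integral (MeasureTheory.volume.restrict cube)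
      (fun θ => (O θ : ℂ) * Complex.exp (-(A θ)))) / Z).re := by
  obtain ⟨K₁, hK₁⟩ := birFixedVolume_stable_of (L := L) (M := M) hr hc₀ c hU1 hN
    (F := fun (φ : (Fin r × Fin r × Fin r) → ℝ) =>
      c.sum (fun n a => a * Complex.exp (Complex.I * ((∑ w, (n w : ℝ) * φ w : ℝ) : ℂ))))
    (fun _ => rfl) hC
    (sh := fun s w => (s.1 + ![((w.1 : ℕ) : ZMod L), ((w.2.1 : ℕ) : ZMod L)],
      s.2 + ((w.2.2 : ℕ) : ZMod M))) (fun _ _ => rfl)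
    (O := fun θ => ‖∑ x : TorusSite 2 L, Complex.exp (Complex.I * (θ (x, 0) : ℂ))‖ ^ 2 / (L : ℝ) ^ 4)
    (fun _ => rfl)
  refine ⟨K₁, fun K hK => ?_⟩
  dsimp only
  exact hK₁ K hK

end FixedVolume

end Summit.HubbardSuperconductivity.HubbardSuperconductivity.Theorems
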